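import Mathlib
import HarnessLib
import Literature.Analysis.FluidPDE.TypeIAncientMild
import Literature.Analysis.FluidPDE.VorticityCalculus
import Summits.NavierStokesRegularity.NavierStokesRegularity.Theorems.PoloidalWindowDoorPoloidalWindowRigidityIslandOrNullCore
import Summits.NavierStokesRegularity.NavierStokesRegularity.Theorems.PoloidalWindowDoorPoloidalWindowRigidityConstantShearMeans
import Summits.NavierStokesRegularity.NavierStokesRegularity.Theorems.PoloidalWindowDoorPoloidalWindowRigidityClebsch
import Summits.NavierStokesRegularity.NavierStokesRegularity.Theorems.PoloidalWindowDoorPoloidalWindowRigidityFirstIntegral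

/-!
# Route `PoloidalWindowDoor`, crux `PoloidalWindowRigidity` (K2, stmt-NavierStokesRegularity-19708) — STUB HP1
# `stub_islandOrNull` of line `hot_loops` v2 (ns-idea-8 g6): HOT ISLANDS SHED LOOPS OR THE PLANE IS LOCALLY IRROTATIONAL

Cell ns-regularity-ideate, seat ns-poloidal-K2-p2 g11 (stub-worker on K2; `--supports` the crux item).

* `stub_islandOrNull` — VERBATIM: for a poloidal profile of the route's Type-I class, a time `s < 0`, a plane `{y₂ = z₀}`,
  a sign `σ = ±1`, a level `M` and an admissible island datum `(K, O)` for `σ v₂(s,·)` (compact non-empty `K` at level `M`,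
  `O ⊇ K` open, `σv₂(s,·) ≤ M` on `O ∩ plane` with the level-`M` points in `K`): EITHER `y′ = curl v(s)(y)` has a
  non-stationary periodic orbit, OR `curl v(s)` vanishes on a planar disc of `{y₂ = z₀}`.  Proof:
  `…IslandOrNullCore.loop_or_nullDisc` for `X = curl v(s)` (horizontal by poloidality), the first integral `f = σv₂(s,·)`
  (frozen law `…FirstIntegral.stub_firstIntegral`) and the Clebsch stream function `ψ` of the slice (`…Clebsch.exists_clebsch_slice`:
  `curl v(s) = (∂₁ψ, −∂₀ψ, 0)`).

WHAT THIS IS NOT: not a claim about Navier–Stokes regularity, not K2/S3 — the provable dichotomy HP1 of an ideator line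
about HYPOTHETICAL poloidal Type-I blow-up profiles; on this line S3 then rests on the named wall S6G (item 27893, via the
proved `LoopPeriodRatchet.NoLoopsOfGrowth`), HP3/HP4 (landed) and the residue HL3.  bears_on LADDER-NS N0, rung
N0-LocalTubeDoorPoloidal.
-/

noncomputable section

-- the summit and its single sub-problem share the name (CONVENTIONS §1), as in every Theorems file
set_option linter.dupNamespace false

namespace Summit.NavierStokesRegularity.NavierStokesRegularity.Theorems.PoloidalWindowDoorPoloidalWindowRigidityHotLoopsIslandOrNull

open MeasureTheory Set Function Filter Topology Metric
open scoped RealInnerProductSpace InnerProductSpace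
open Literature.Analysis Literature.Analysis.FluidPDE
open Summit.NavierStokesRegularity.NavierStokesRegularity.Theorems.PoloidalWindowDoorPoloidalWindowRigidityConstantShearMeans
open Summit.NavierStokesRegularity.NavierStokesRegularity.Theorems.PoloidalWindowDoorPoloidalWindowRigidityWindow
open Summit.NavierStokesRegularity.NavierStokesRegularity.Theorems.PoloidalWindowDoorPoloidalWindowRigidityFirstIntegral
open Summit.NavierStokesRegularity.NavierStokesRegularity.Theorems.PoloidalWindowDoorPoloidalWindowRigidityClebsch
open Summit.NavierStokesRegularity.NavierStokesRegularity.Theorems.PoloidalWindowDoorPoloidalWindowRigidityIslandOrNullCore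

/-- **STUB HP1 `stub_islandOrNull` (VERBATIM, line `hot_loops` v2 of crux `PoloidalWindowRigidity`): HOT ISLANDS OR DEAD PLANES.** -/
theorem stub_islandOrNull :
    ∀ (C : ℝ) (v : ℝ → EuclideanSpace ℝ (Fin 3) → EuclideanSpace ℝ (Fin 3)),
      Literature.Analysis.FluidPDE.HasTypeITimeDecay C v →
      ContinuousOn (Function.uncurry v) (Set.Iio (0 : ℝ) ×ˢ Set.univ) →
      (∀ s t : ℝ, s < t → t < 0 → ∀ x, v t x =
        Literature.Analysis.UnboundedOperators.heatExtension (v s) (t - s) x -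
          Literature.Analysis.FluidPDE.oseenDuhamel 1 s v v t x) →
      (∀ t < 0, Literature.Analysis.FluidPDE.VectorCalculus.IsDivFree (v t)) →
      (∀ s < 0, ∀ y, ⟪Literature.Analysis.FluidPDE.curl (v s) y, EuclideanSpace.single 2 1⟫_ℝ = 0) →
      ∀ (s z₀ σ M : ℝ) (K O : Set (EuclideanSpace ℝ (Fin 3))), s < 0 →
        ((σ = 1 ∨ σ = -1) ∧ IsCompact K ∧ K.Nonempty ∧ (∀ y ∈ K, y 2 = z₀ ∧ σ * v s y 2 = M) ∧
          IsOpen O ∧ K ⊆ O ∧ (∀ y ∈ O, y 2 = z₀ → σ * v s y 2 ≤ M) ∧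
          (∀ y ∈ O, y 2 = z₀ → σ * v s y 2 = M → y ∈ K)) →
        (∃ (γ : ℝ → EuclideanSpace ℝ (Fin 3)) (ℓ : ℝ), 0 < ℓ ∧
          (∀ θ, HasDerivAt γ (Literature.Analysis.FluidPDE.curl (v s) (γ θ)) θ) ∧
          (∀ θ, γ (θ + ℓ) = γ θ) ∧ Literature.Analysis.FluidPDE.curl (v s) (γ 0) ≠ 0) ∨
        (∃ (y₀ : EuclideanSpace ℝ (Fin 3)) (r : ℝ), y₀ 2 = z₀ ∧ 0 < r ∧
          ∀ y : EuclideanSpace ℝ (Fin 3), y 2 = z₀ → dist y y₀ < r → Literature.Analysis.FluidPDE.curl (v s) y = 0) := by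
  intro C v hrate hcont hmild hdiv hpol s z₀ σ M K O hs hdat
  obtain ⟨-, hKc, hKne, hKM, hO, hKO, hle, hiso⟩ := hdat
  obtain ⟨y₀, hy₀⟩ := hKne
  have hy₀2 : y₀ 2 = z₀ := (hKM y₀ hy₀).1
  -- the slice, its curl and the frozen law
  have hA : IsTypeIAncientMild C v := isTypeIAncientMild_of_class hrate hcont hmild hdiv
  have hvs : ContDiff ℝ (⊤ : ℕ∞) (v s) := hA.contDiff_slice hs
  have hV3 : ContDiff ℝ 3 (v s) := contDiff_infty.1 hvs 3
  have hVd : Differentiable ℝ (v s) := hV3.differentiable (by norm_num)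
  have hX : ContDiff ℝ 2 (curl (v s)) := contDiff_curl (n := 2) (by exact_mod_cast hV3)
  have hX2 : ∀ y, curl (v s) y 2 = 0 := fun y => by
    simpa [EuclideanSpace.inner_single_right] using hpol s hs y
  have hfrozen : ∀ y, fderiv ℝ (v s) y (curl (v s) y) 2 = 0 := fun y => by
    have h := stub_firstIntegral C v hrate hcont hmild hdiv (EuclideanSpace.single 2 1) hpol s hs y
    simpa [EuclideanSpace.inner_single_right] using h
  -- the first integral `f = σ v₂(s,·)`
  have hf3 : ContDiff ℝ 3 (fun y => σ * v s y 2) := contDiff_const.mul (contDiff_coord hV3 2)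
  have hfX : ∀ y, fderiv ℝ (fun y => σ * v s y 2) y (curl (v s) y) = 0 := fun y => by
    rw [fderiv_const_mul ((contDiff_coord hV3 2).differentiable (by norm_num) y)]
    simp only [FunLike.coe_smul, Pi.smul_apply, smul_eq_mul]
    rw [fderiv_coord_apply (hVd y) 2, hfrozen, mul_zero]
  -- the Clebsch stream function of the slice
  obtain ⟨φc, ψ, -, hψs, -, -, -, -, hcomp, -, -, -⟩ := exists_clebsch_slice hrate hcont hmild hdiv hpol hs
  have hG : ContDiff ℝ 1 ψ := hψs.of_le (by exact_mod_cast le_top)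
  have hG0 : ∀ y, fderiv ℝ ψ y (EuclideanSpace.single 0 1) = -(curl (v s) y 1) := fun y => by
    rw [(hcomp y).2.1, neg_neg]
  have hG1 : ∀ y, fderiv ℝ ψ y (EuclideanSpace.single 1 1) = curl (v s) y 0 := fun y => (hcomp y).1.symm
  -- the island data in the plane of `y₀`
  have hKf : ∀ y ∈ K, y 2 = y₀ 2 ∧ σ * v s y 2 = M := fun y hy => ⟨(hKM y hy).1.trans hy₀2.symm, (hKM y hy).2⟩
  have hfle : ∀ y : EuclideanSpace ℝ (Fin 3), y 2 = y₀ 2 → y ∈ O → σ * v s y 2 ≤ M := fun y hy hyO =>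
    hle y hyO (hy.trans hy₀2)
  have hiso' : ∀ y ∈ O, y 2 = y₀ 2 → σ * v s y 2 = M → y ∈ K := fun y hy hy2 => hiso y hy (hy2.trans hy₀2)
  rcases loop_or_nullDisc hX hX2 hf3 hfX hG hG0 hG1 hKc hy₀ hKf hO hKO hfle hiso' with hloop | ⟨y₁, r, hy₁, hr, hnull⟩
  · exact Or.inl hloop
  · exact Or.inr ⟨y₁, r, hy₁.trans hy₀2, hr, fun y hy hyd => hnull y (hy.trans hy₀2.symm) hyd⟩

end Summit.NavierStokesRegularity.NavierStokesRegularity.Theorems.PoloidalWindowDoorPoloidalWindowRigidityHotLoopsIslandOrNull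

end
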